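import Summits.QuantumFields.BalabanUV.Beta.FP.SliceTransportConjugationEnd
import Summits.QuantumFields.BalabanUV.Beta.FP.ExponentialTransportJets

/-!
# `BalabanUV.Beta.FP.ExponentialTransportEnd` — road «FP» for binder row D1, ROUTE T, presentation T-β (W-FP-17-11 ∕ memo `N2B-DESIGN.md` §23 (23b)):
# **THE SLICED 2-JET WITH A STATIC SLICE IS INVARIANT UNDER EXPONENTIAL CONJUGATION TRANSPORT WHOSE GENERATOR INTERTWINES THE GAUGE MODES — ZERO FADDEEV–POPOV COST**

WHAT.  Composition BY NAME of the OWNER's `SliceTransportConjugationEnd.secondVar_kkt_conj_transport` (I-FP-17-11) at the one-parameter-group jets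
`A := (1, X, X·X)`, `B := (1, −X, X·X)`, `Ā := (1, X̄, X̄·X̄)` — its five letters `b0 b1 b2 uA uĀ` discharged by `ExponentialTransportJets` §1 — with the UN-MOVE
`ExponentialTransportJets.secondVar_kkt_unmove_expJet` (§3 there; the OWNER's `SliceExchangeJets.secondVar_kkt_slice_change_jets_of_range` + (T-β-4) from first-order
intertwining): for sliced bordered 2-jets `(K₀,K₁,K₂)`, `(Q₀,Q₁,Q₂)` carrying the slice-exchange Ward letters of a STATIC generator `W₀` (frame of record,
TID-LETTER-SPEC § E; the MOVING-generator twin `secondVar_kkt_expConj_moving` takes generator jets `(W₀,W₁,W₂)` and `X·W₁ = W₁·Z` too), a static slice `τ` (`det(τW₀) ≠ 0`, `det (kkt K₀ [Q₀;τ]) ≠ 0`) and a field-transport generator `X` with `X·W₀ = W₀·Z`: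
`secondVar (kkt K₀ [Q₀; τ]) (kkt K₁′ [Q₁′; 0]) (kkt K₂′ [Q₂′; 0]) = secondVar (kkt K₀ [Q₀; τ]) (kkt K₁ [Q₁; 0]) (kkt K₂ [Q₂; 0])` where `K₁′ K₂′ Q₁′ Q₂′` are the
`X ∕ X̄`-CONJUGATED first ∕ second words (DISPLAYED by defining equations, the OWNER's grouping with the unit jets erased).  Letters LEFT for the dictionary:
(T-β-1) «the tables' jets along `Π_big e_b` ARE `K₁′ K₂′ Q₁′ Q₂′` for the tables' jets `K₁ K₂ Q₁ Q₂` along `Π_small e_b`» and the intertwining `X·W₀ = W₀·Z`.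
GENERIC LETTER FORM (`secondVar_kkt_conjTransport_static_of_intertwine`): the same with ANY transports `A Ā B` and memo §23 (23b)'s (T-β-2∕3∕4) AS LETTERS
(`b0 b1 b2 uA uĀ`, intertwining `i0 i1 i2 : (B·W)ₙ = (W·C)ₙ`, `uC : secondVar C₀ C₁ C₂ = 0`) — S1 of the OWNER's gen-17 HANDOFF read on the fine system.
NOT HERE: what `X X̄` (or `A Ā B C`) are for the literal, any table identity, any estimate.

HONEST DEPENDENCY (page 1, mandatory): continuum YM on T⁴ ⇐ BetaPertH ∧ nine spine estimates (0/9 proved); BetaPertH ⇐ (D1) ∧ (D4) ∧ CAP+tail;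
G-an2-4 gates asym, D1 and NE2/3/4.  HONEST FRAMING (cell contract, verbatim): «discharging `BetaPertH` makes Bałaban's UV stability UNCONDITIONAL —
a real constructive-QFT result; it is NOT the continuum limit and NOT the Clay problem.»  ABSOLUTE RULE (cell charter, verbatim): «No internally-minted
statement may enter as a cited fact. Every hypothesis is either kernel-proved in this package or a verbatim quotation of a PUBLISHED theorem with page
reference. The manuscript(s) under audit are NOT citable for their own disputed steps — they are the thing under adjudication; programme-internal
(2001/route/tribunal) claims are never citable.»  [folklore] composition BY NAME; no `def`, no `def … : Prop`, nothing cited, 0 sorry; 0 estimates;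
0∕4 row-D1 binders; NOT the dictionary, NOT (T-ID), NOT SDF, NOT D1, NOT BetaPertH, NOT continuum, NOT Clay.  «not in print; our bookkeeping».
Provenance: D1 formalisation swarm LEAF PROVER 06, unit b2b-balaban-beta-d1-formalise-leaf-06 gen 18, 2026-08-22.  No existing file touched.
-/

noncomputable section

namespace Summit.QuantumFields.BalabanUV.Beta.FP.ExponentialTransportEnd

open Matrix
open Literature.MathematicalPhysics.QuantumFieldTheory.Balaban1983to89.Beta.Composition (kkt)
open Summit.QuantumFields.BalabanUV.Beta.D1BFx.LogDetSecondVariation (secondVar)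
open Summit.QuantumFields.BalabanUV.Beta.FP.SliceTransportConjugationEnd (secondVar_kkt_conj_transport)
open Summit.QuantumFields.BalabanUV.Beta.FP.ExponentialTransportJets (expJet_b0 expJet_b1 expJet_b2 secondVar_expJet det_expJet₀_ne_zero
  secondVar_kkt_unmove_expJet secondVar_kkt_unmove_expJet_of_sliced secondVar_kkt_unmove_expJet_moving secondVar_kkt_unmove_of_intertwine)

variable {ν μ ρ : Type*} [Fintype ν] [Fintype μ] [Fintype ρ] [DecidableEq ν] [DecidableEq μ] [DecidableEq ρ]

/-- [folklore] **EXPONENTIAL CONJUGATION TRANSPORT WITH A STATIC SLICE, SLICED INTERTWINING.**  The `X ∕ X̄`-conjugated first and second words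
`K₁′ = XᵀK₀ + K₁ + K₀X`, `K₂′ = (X·X)ᵀK₀ + (XᵀK₁ + XᵀK₀X) + ((XᵀK₁ + XᵀK₀X) + (K₂ + K₁X + (K₁X + K₀(X·X))))`, `Q₁′ = X̄Q₀ + Q₁ + Q₀X`,
`Q₂′ = (X̄·X̄)Q₀ + (X̄Q₁ + X̄Q₀X) + ((X̄Q₁ + X̄Q₀X) + (Q₂ + Q₁X + (Q₁X + Q₀(X·X))))` (the OWNER's `secondVar_kkt_conj_transport` words at the exponential jets,
unit jets erased; bound by defining equations), sliced by the STATIC `τ` with zero slice jets, have the `secondVar` of the raw sliced 2-jet — under the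
slice-exchange Ward letters for the static generator `W₀`, `det(τW₀) ≠ 0`, `det (kkt K₀ [Q₀; τ]) ≠ 0` and the SLICED intertwinings
`τ·X·W₀ = τ·W₀·Z`, `τ·(X·X)·W₀ = τ·W₀·(Z·Z)`. -/
theorem secondVar_kkt_expConj_static_of_sliced (K₀ K₁ K₂ : Matrix ν ν ℝ) (Q₀ Q₁ Q₂ : Matrix μ ν ℝ) (τ : Matrix ρ ν ℝ) (W₀ : Matrix ν ρ ℝ)
    (X : Matrix ν ν ℝ) (Xbar : Matrix μ μ ℝ) (Z : Matrix ρ ρ ℝ) (Y₀ Y₁ Y₂ Y'₀ Y'₁ Y'₂ : Matrix μ ρ ℝ)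
    (a0 : K₀ * W₀ = Q₀ᵀ * Y₀) (a1 : K₁ * W₀ = Q₁ᵀ * Y₀ + Q₀ᵀ * Y₁) (a2 : K₂ * W₀ = Q₂ᵀ * Y₀ + (2 : ℝ) • (Q₁ᵀ * Y₁) + Q₀ᵀ * Y₂)
    (a0t : K₀ᵀ * W₀ = Q₀ᵀ * Y'₀) (a1t : K₁ᵀ * W₀ = Q₁ᵀ * Y'₀ + Q₀ᵀ * Y'₁) (a2t : K₂ᵀ * W₀ = Q₂ᵀ * Y'₀ + (2 : ℝ) • (Q₁ᵀ * Y'₁) + Q₀ᵀ * Y'₂)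
    (b0 : Q₀ * W₀ = 0) (b1 : Q₁ * W₀ = 0) (b2 : Q₂ * W₀ = 0)
    (hτ : (τ * W₀).det ≠ 0) (h0 : (kkt K₀ (fromRows Q₀ τ)).det ≠ 0)
    (h1 : τ * X * W₀ = τ * W₀ * Z) (h2 : τ * (X * X) * W₀ = τ * W₀ * (Z * Z))
    {K₁' K₂' : Matrix ν ν ℝ} {Q₁' Q₂' : Matrix μ ν ℝ}
    (hK₁' : K₁' = Xᵀ * K₀ + K₁ + K₀ * X)
    (hK₂' : K₂' = (X * X)ᵀ * K₀ + (Xᵀ * K₁ + Xᵀ * K₀ * X) + ((Xᵀ * K₁ + Xᵀ * K₀ * X) + (K₂ + K₁ * X + (K₁ * X + K₀ * (X * X)))))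
    (hQ₁' : Q₁' = Xbar * Q₀ + Q₁ + Q₀ * X)
    (hQ₂' : Q₂' = Xbar * Xbar * Q₀ + (Xbar * Q₁ + Xbar * Q₀ * X) + ((Xbar * Q₁ + Xbar * Q₀ * X) + (Q₂ + Q₁ * X + (Q₁ * X + Q₀ * (X * X))))) :
    secondVar (kkt K₀ (fromRows Q₀ τ)) (kkt K₁' (fromRows Q₁' (0 : Matrix ρ ν ℝ))) (kkt K₂' (fromRows Q₂' (0 : Matrix ρ ν ℝ)))
      = secondVar (kkt K₀ (fromRows Q₀ τ)) (kkt K₁ (fromRows Q₁ (0 : Matrix ρ ν ℝ))) (kkt K₂ (fromRows Q₂ (0 : Matrix ρ ν ℝ))) := by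
  subst hK₁' hK₂' hQ₁' hQ₂'
  have hM : (kkt K₀ (fromRows Q₀ (τ * (1 : Matrix ν ν ℝ)))).det ≠ 0 := by rw [Matrix.mul_one]; exact h0
  have h := secondVar_kkt_conj_transport (1 : Matrix ν ν ℝ) X (X * X) (1 : Matrix ν ν ℝ) (-X) (X * X) K₀ K₁ K₂
    (1 : Matrix μ μ ℝ) Xbar (Xbar * Xbar) Q₀ Q₁ Q₂ τ det_expJet₀_ne_zero det_expJet₀_ne_zero hM
    expJet_b0 (expJet_b1 X) (expJet_b2 X) (secondVar_expJet X) (secondVar_expJet Xbar)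
  simp only [Matrix.transpose_one, Matrix.one_mul, Matrix.mul_one] at h
  rw [secondVar_kkt_unmove_expJet_of_sliced K₀ K₁ K₂ Q₀ Q₁ Q₂ τ W₀ X Z Y₀ Y₁ Y₂ Y'₀ Y'₁ Y'₂ a0 a1 a2 a0t a1t a2t b0 b1 b2 hτ h0 h1 h2] at h
  exact h

/-- [folklore] **EXPONENTIAL CONJUGATION TRANSPORT WITH A STATIC SLICE — ZERO FADDEEV–POPOV COST** under honest first-order intertwining `X·W₀ = W₀·Z`:
as `secondVar_kkt_expConj_static_of_sliced`. -/
theorem secondVar_kkt_expConj_static (K₀ K₁ K₂ : Matrix ν ν ℝ) (Q₀ Q₁ Q₂ : Matrix μ ν ℝ) (τ : Matrix ρ ν ℝ) (W₀ : Matrix ν ρ ℝ)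
    (X : Matrix ν ν ℝ) (Xbar : Matrix μ μ ℝ) (Z : Matrix ρ ρ ℝ) (Y₀ Y₁ Y₂ Y'₀ Y'₁ Y'₂ : Matrix μ ρ ℝ)
    (a0 : K₀ * W₀ = Q₀ᵀ * Y₀) (a1 : K₁ * W₀ = Q₁ᵀ * Y₀ + Q₀ᵀ * Y₁) (a2 : K₂ * W₀ = Q₂ᵀ * Y₀ + (2 : ℝ) • (Q₁ᵀ * Y₁) + Q₀ᵀ * Y₂)
    (a0t : K₀ᵀ * W₀ = Q₀ᵀ * Y'₀) (a1t : K₁ᵀ * W₀ = Q₁ᵀ * Y'₀ + Q₀ᵀ * Y'₁) (a2t : K₂ᵀ * W₀ = Q₂ᵀ * Y'₀ + (2 : ℝ) • (Q₁ᵀ * Y'₁) + Q₀ᵀ * Y'₂)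
    (b0 : Q₀ * W₀ = 0) (b1 : Q₁ * W₀ = 0) (b2 : Q₂ * W₀ = 0)
    (hτ : (τ * W₀).det ≠ 0) (h0 : (kkt K₀ (fromRows Q₀ τ)).det ≠ 0) (hX : X * W₀ = W₀ * Z)
    {K₁' K₂' : Matrix ν ν ℝ} {Q₁' Q₂' : Matrix μ ν ℝ}
    (hK₁' : K₁' = Xᵀ * K₀ + K₁ + K₀ * X)
    (hK₂' : K₂' = (X * X)ᵀ * K₀ + (Xᵀ * K₁ + Xᵀ * K₀ * X) + ((Xᵀ * K₁ + Xᵀ * K₀ * X) + (K₂ + K₁ * X + (K₁ * X + K₀ * (X * X)))))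
    (hQ₁' : Q₁' = Xbar * Q₀ + Q₁ + Q₀ * X)
    (hQ₂' : Q₂' = Xbar * Xbar * Q₀ + (Xbar * Q₁ + Xbar * Q₀ * X) + ((Xbar * Q₁ + Xbar * Q₀ * X) + (Q₂ + Q₁ * X + (Q₁ * X + Q₀ * (X * X))))) :
    secondVar (kkt K₀ (fromRows Q₀ τ)) (kkt K₁' (fromRows Q₁' (0 : Matrix ρ ν ℝ))) (kkt K₂' (fromRows Q₂' (0 : Matrix ρ ν ℝ)))
      = secondVar (kkt K₀ (fromRows Q₀ τ)) (kkt K₁ (fromRows Q₁ (0 : Matrix ρ ν ℝ))) (kkt K₂ (fromRows Q₂ (0 : Matrix ρ ν ℝ))) := by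
  have hXX : X * X * W₀ = W₀ * (Z * Z) := by
    rw [Matrix.mul_assoc, hX, ← Matrix.mul_assoc, hX, Matrix.mul_assoc]
  exact secondVar_kkt_expConj_static_of_sliced K₀ K₁ K₂ Q₀ Q₁ Q₂ τ W₀ X Xbar Z Y₀ Y₁ Y₂ Y'₀ Y'₁ Y'₂ a0 a1 a2 a0t a1t a2t b0 b1 b2 hτ h0
    (by rw [Matrix.mul_assoc, hX, ← Matrix.mul_assoc]) (by rw [Matrix.mul_assoc, hXX, ← Matrix.mul_assoc]) hK₁' hK₂' hQ₁' hQ₂'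

/-- [folklore] **EXPONENTIAL CONJUGATION TRANSPORT WITH A STATIC SLICE, MOVING GENERATOR — ZERO FADDEEV–POPOV COST**: as `secondVar_kkt_expConj_static`
with generator JETS `(W₀, W₁, W₂)` (the slice-exchange letters of `SliceExchangeJets.secondVar_kkt_slice_change_jets_of_range` VERBATIM at `P := τ`) and the
first-order intertwinings `X·W₀ = W₀·Z`, `X·W₁ = W₁·Z` (`ExponentialTransportJets.secondVar_kkt_unmove_expJet_moving`). -/
theorem secondVar_kkt_expConj_moving (K₀ K₁ K₂ : Matrix ν ν ℝ) (Q₀ Q₁ Q₂ : Matrix μ ν ℝ) (τ : Matrix ρ ν ℝ) (W₀ W₁ W₂ : Matrix ν ρ ℝ)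
    (X : Matrix ν ν ℝ) (Xbar : Matrix μ μ ℝ) (Z : Matrix ρ ρ ℝ) (Y₀ Y₁ Y₂ Y'₀ Y'₁ Y'₂ : Matrix μ ρ ℝ)
    (a0 : K₀ * W₀ = Q₀ᵀ * Y₀) (a1 : K₁ * W₀ + K₀ * W₁ = Q₁ᵀ * Y₀ + Q₀ᵀ * Y₁)
    (a2 : K₂ * W₀ + (2 : ℝ) • (K₁ * W₁) + K₀ * W₂ = Q₂ᵀ * Y₀ + (2 : ℝ) • (Q₁ᵀ * Y₁) + Q₀ᵀ * Y₂)
    (a0t : K₀ᵀ * W₀ = Q₀ᵀ * Y'₀) (a1t : K₁ᵀ * W₀ + K₀ᵀ * W₁ = Q₁ᵀ * Y'₀ + Q₀ᵀ * Y'₁)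
    (a2t : K₂ᵀ * W₀ + (2 : ℝ) • (K₁ᵀ * W₁) + K₀ᵀ * W₂ = Q₂ᵀ * Y'₀ + (2 : ℝ) • (Q₁ᵀ * Y'₁) + Q₀ᵀ * Y'₂)
    (b0 : Q₀ * W₀ = 0) (b1 : Q₁ * W₀ + Q₀ * W₁ = 0) (b2 : Q₂ * W₀ + (2 : ℝ) • (Q₁ * W₁) + Q₀ * W₂ = 0)
    (hτ : (τ * W₀).det ≠ 0) (h0 : (kkt K₀ (fromRows Q₀ τ)).det ≠ 0) (hX₀ : X * W₀ = W₀ * Z) (hX₁ : X * W₁ = W₁ * Z)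
    {K₁' K₂' : Matrix ν ν ℝ} {Q₁' Q₂' : Matrix μ ν ℝ}
    (hK₁' : K₁' = Xᵀ * K₀ + K₁ + K₀ * X)
    (hK₂' : K₂' = (X * X)ᵀ * K₀ + (Xᵀ * K₁ + Xᵀ * K₀ * X) + ((Xᵀ * K₁ + Xᵀ * K₀ * X) + (K₂ + K₁ * X + (K₁ * X + K₀ * (X * X)))))
    (hQ₁' : Q₁' = Xbar * Q₀ + Q₁ + Q₀ * X)
    (hQ₂' : Q₂' = Xbar * Xbar * Q₀ + (Xbar * Q₁ + Xbar * Q₀ * X) + ((Xbar * Q₁ + Xbar * Q₀ * X) + (Q₂ + Q₁ * X + (Q₁ * X + Q₀ * (X * X))))) :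
    secondVar (kkt K₀ (fromRows Q₀ τ)) (kkt K₁' (fromRows Q₁' (0 : Matrix ρ ν ℝ))) (kkt K₂' (fromRows Q₂' (0 : Matrix ρ ν ℝ)))
      = secondVar (kkt K₀ (fromRows Q₀ τ)) (kkt K₁ (fromRows Q₁ (0 : Matrix ρ ν ℝ))) (kkt K₂ (fromRows Q₂ (0 : Matrix ρ ν ℝ))) := by
  subst hK₁' hK₂' hQ₁' hQ₂'
  have hM : (kkt K₀ (fromRows Q₀ (τ * (1 : Matrix ν ν ℝ)))).det ≠ 0 := by rw [Matrix.mul_one]; exact h0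
  have h := secondVar_kkt_conj_transport (1 : Matrix ν ν ℝ) X (X * X) (1 : Matrix ν ν ℝ) (-X) (X * X) K₀ K₁ K₂
    (1 : Matrix μ μ ℝ) Xbar (Xbar * Xbar) Q₀ Q₁ Q₂ τ det_expJet₀_ne_zero det_expJet₀_ne_zero hM
    expJet_b0 (expJet_b1 X) (expJet_b2 X) (secondVar_expJet X) (secondVar_expJet Xbar)
  simp only [Matrix.transpose_one, Matrix.one_mul, Matrix.mul_one] at h
  rw [secondVar_kkt_unmove_expJet_moving K₀ K₁ K₂ Q₀ Q₁ Q₂ τ W₀ W₁ W₂ X Z Y₀ Y₁ Y₂ Y'₀ Y'₁ Y'₂ a0 a1 a2 a0t a1t a2t b0 b1 b2 hτ h0 hX₀ hX₁] at h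
  exact h

/-- [folklore] **GENERIC CONJUGATION TRANSPORT WITH A STATIC SLICE — memo §23 (23b) WITH (T-β-2∕3∕4) AS LETTERS.**  The OWNER's `secondVar_kkt_conj_transport`
(transports `A Ā`, inverse `B`: `hA hĀ b0 b1 b2 uA uĀ`) composed with the generic un-move `ExponentialTransportJets.secondVar_kkt_unmove_of_intertwine`
(slice-exchange letters for the generator jets `W₀ W₁ W₂` at `P := τ`; intertwining letters `i0 i1 i2 : (B·W)ₙ = (W·C)ₙ`, `uC : secondVar C₀ C₁ C₂ = 0`, `det C₀ ≠ 0`;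
non-degeneracies `det(τW₀) ≠ 0`, `det(τB₀W₀) ≠ 0`, `det (kkt K₀ [Q₀; τB₀]) ≠ 0`): the conjugated sliced 2-jet with the STATIC slice `τ` has the `secondVar` of the RAW
sliced 2-jet with the SAME static slice — ZERO Faddeev–Popov cost.  (S1 of the OWNER's gen-17 HANDOFF «p308750 ∘ `secondVar_kkt_conj_transport` on the fine system»
is this identity read at `(K, Q, τ, W) :=` the fine one-step system; the exponential specialisations above need no `b* u* uC`.) -/
theorem secondVar_kkt_conjTransport_static_of_intertwine (A₀ A₁ A₂ B₀ B₁ B₂ K₀ K₁ K₂ : Matrix ν ν ℝ) (Ā₀ Ā₁ Ā₂ : Matrix μ μ ℝ) (Q₀ Q₁ Q₂ : Matrix μ ν ℝ)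
    (τ : Matrix ρ ν ℝ) (W₀ W₁ W₂ : Matrix ν ρ ℝ) (C₀ C₁ C₂ : Matrix ρ ρ ℝ) (Y₀ Y₁ Y₂ Y'₀ Y'₁ Y'₂ : Matrix μ ρ ℝ)
    (hA : A₀.det ≠ 0) (hĀ : Ā₀.det ≠ 0)
    (b0 : B₀ * A₀ = 1) (b1 : B₁ * A₀ + B₀ * A₁ = 0) (b2 : B₂ * A₀ + (2 : ℝ) • (B₁ * A₁) + B₀ * A₂ = 0)
    (uA : secondVar A₀ A₁ A₂ = 0) (uĀ : secondVar Ā₀ Ā₁ Ā₂ = 0)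
    (a0 : K₀ * W₀ = Q₀ᵀ * Y₀) (a1 : K₁ * W₀ + K₀ * W₁ = Q₁ᵀ * Y₀ + Q₀ᵀ * Y₁)
    (a2 : K₂ * W₀ + (2 : ℝ) • (K₁ * W₁) + K₀ * W₂ = Q₂ᵀ * Y₀ + (2 : ℝ) • (Q₁ᵀ * Y₁) + Q₀ᵀ * Y₂)
    (a0t : K₀ᵀ * W₀ = Q₀ᵀ * Y'₀) (a1t : K₁ᵀ * W₀ + K₀ᵀ * W₁ = Q₁ᵀ * Y'₀ + Q₀ᵀ * Y'₁)
    (a2t : K₂ᵀ * W₀ + (2 : ℝ) • (K₁ᵀ * W₁) + K₀ᵀ * W₂ = Q₂ᵀ * Y'₀ + (2 : ℝ) • (Q₁ᵀ * Y'₁) + Q₀ᵀ * Y'₂)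
    (c0 : Q₀ * W₀ = 0) (c1 : Q₁ * W₀ + Q₀ * W₁ = 0) (c2 : Q₂ * W₀ + (2 : ℝ) • (Q₁ * W₁) + Q₀ * W₂ = 0)
    (hτ : (τ * W₀).det ≠ 0) (hτB : (τ * B₀ * W₀).det ≠ 0) (h0 : (kkt K₀ (fromRows Q₀ (τ * B₀))).det ≠ 0) (hC : C₀.det ≠ 0)
    (i0 : B₀ * W₀ = W₀ * C₀) (i1 : B₁ * W₀ + B₀ * W₁ = W₁ * C₀ + W₀ * C₁)
    (i2 : B₂ * W₀ + (2 : ℝ) • (B₁ * W₁) + B₀ * W₂ = W₂ * C₀ + (2 : ℝ) • (W₁ * C₁) + W₀ * C₂) (uC : secondVar C₀ C₁ C₂ = 0) :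
   
    secondVar (kkt (A₀ᵀ * K₀ * A₀) (fromRows (Ā₀ * Q₀ * A₀) τ))
        (kkt (A₁ᵀ * K₀ * A₀ + A₀ᵀ * K₁ * A₀ + A₀ᵀ * K₀ * A₁) (fromRows (Ā₁ * Q₀ * A₀ + Ā₀ * Q₁ * A₀ + Ā₀ * Q₀ * A₁) (0 : Matrix ρ ν ℝ)))
        (kkt (A₂ᵀ * K₀ * A₀ + (A₁ᵀ * K₁ * A₀ + A₁ᵀ * K₀ * A₁) + ((A₁ᵀ * K₁ * A₀ + A₁ᵀ * K₀ * A₁) + (A₀ᵀ * K₂ * A₀ + A₀ᵀ * K₁ * A₁ + (A₀ᵀ * K₁ * A₁ + A₀ᵀ * K₀ * A₂))))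
          (fromRows (Ā₂ * Q₀ * A₀ + (Ā₁ * Q₁ * A₀ + Ā₁ * Q₀ * A₁) + ((Ā₁ * Q₁ * A₀ + Ā₁ * Q₀ * A₁) + (Ā₀ * Q₂ * A₀ + Ā₀ * Q₁ * A₁ + (Ā₀ * Q₁ * A₁ + Ā₀ * Q₀ * A₂))))
            (0 : Matrix ρ ν ℝ)))
      = secondVar (kkt K₀ (fromRows Q₀ τ)) (kkt K₁ (fromRows Q₁ (0 : Matrix ρ ν ℝ))) (kkt K₂ (fromRows Q₂ (0 : Matrix ρ ν ℝ))) := by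
  rw [secondVar_kkt_conj_transport A₀ A₁ A₂ B₀ B₁ B₂ K₀ K₁ K₂ Ā₀ Ā₁ Ā₂ Q₀ Q₁ Q₂ τ hA hĀ h0 b0 b1 b2 uA uĀ,
    secondVar_kkt_unmove_of_intertwine K₀ K₁ K₂ Q₀ Q₁ Q₂ τ W₀ W₁ W₂ B₀ B₁ B₂ C₀ C₁ C₂ Y₀ Y₁ Y₂ Y'₀ Y'₁ Y'₂ a0 a1 a2 a0t a1t a2t c0 c1 c2
      hτ hτB h0 hC i0 i1 i2 uC]

/-- [folklore] **GENERIC LETTERS, TRANSPORT THROUGH THE IDENTITY** (`A₀ = Ā₀ = B₀ = C₀ = 1` — the two charts' background families AGREE at `u = 0`; the shape S1 of the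
OWNER's gen-17 HANDOFF consumes): with the conjugated words DISPLAYED by defining equations (unit jets erased)
`K₁′ = A₁ᵀK₀ + K₁ + K₀A₁`, `K₂′ = A₂ᵀK₀ + (A₁ᵀK₁ + A₁ᵀK₀A₁) + ((A₁ᵀK₁ + A₁ᵀK₀A₁) + (K₂ + K₁A₁ + (K₁A₁ + K₀A₂)))`, `Q₁′ = Ā₁Q₀ + Q₁ + Q₀A₁`,
`Q₂′ = Ā₂Q₀ + (Ā₁Q₁ + Ā₁Q₀A₁) + ((Ā₁Q₁ + Ā₁Q₀A₁) + (Q₂ + Q₁A₁ + (Q₁A₁ + Q₀A₂)))`, the letters (T-β-3) `b1 : B₁ + A₁ = 0`, `b2 : B₂ + 2•(B₁A₁) + A₂ = 0`, (T-β-2)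
`uA : secondVar 1 A₁ A₂ = 0`, `uĀ : secondVar 1 Ā₁ Ā₂ = 0`, (T-β-4) `i1 : B₁W₀ = W₀C₁`, `i2 : B₂W₀ + 2•(B₁W₁) = 2•(W₁C₁) + W₀C₂`, `uC : secondVar 1 C₁ C₂ = 0`, and the
slice-exchange Ward letters of the generator jets: `secondVar (kkt K₀ [Q₀; τ]) (kkt K₁′ [Q₁′; 0]) (kkt K₂′ [Q₂′; 0]) = secondVar (kkt K₀ [Q₀; τ]) (kkt K₁ [Q₁; 0]) (kkt K₂ [Q₂; 0])`. -/
theorem secondVar_kkt_conjTransport_static_one (A₁ A₂ B₁ B₂ K₀ K₁ K₂ : Matrix ν ν ℝ) (Ā₁ Ā₂ : Matrix μ μ ℝ) (Q₀ Q₁ Q₂ : Matrix μ ν ℝ)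
    (τ : Matrix ρ ν ℝ) (W₀ W₁ W₂ : Matrix ν ρ ℝ) (C₁ C₂ : Matrix ρ ρ ℝ) (Y₀ Y₁ Y₂ Y'₀ Y'₁ Y'₂ : Matrix μ ρ ℝ)
    (b1 : B₁ + A₁ = 0) (b2 : B₂ + (2 : ℝ) • (B₁ * A₁) + A₂ = 0)
    (uA : secondVar (1 : Matrix ν ν ℝ) A₁ A₂ = 0) (uĀ : secondVar (1 : Matrix μ μ ℝ) Ā₁ Ā₂ = 0)
    (a0 : K₀ * W₀ = Q₀ᵀ * Y₀) (a1 : K₁ * W₀ + K₀ * W₁ = Q₁ᵀ * Y₀ + Q₀ᵀ * Y₁)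
    (a2 : K₂ * W₀ + (2 : ℝ) • (K₁ * W₁) + K₀ * W₂ = Q₂ᵀ * Y₀ + (2 : ℝ) • (Q₁ᵀ * Y₁) + Q₀ᵀ * Y₂)
    (a0t : K₀ᵀ * W₀ = Q₀ᵀ * Y'₀) (a1t : K₁ᵀ * W₀ + K₀ᵀ * W₁ = Q₁ᵀ * Y'₀ + Q₀ᵀ * Y'₁)
    (a2t : K₂ᵀ * W₀ + (2 : ℝ) • (K₁ᵀ * W₁) + K₀ᵀ * W₂ = Q₂ᵀ * Y'₀ + (2 : ℝ) • (Q₁ᵀ * Y'₁) + Q₀ᵀ * Y'₂)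
    (c0 : Q₀ * W₀ = 0) (c1 : Q₁ * W₀ + Q₀ * W₁ = 0) (c2 : Q₂ * W₀ + (2 : ℝ) • (Q₁ * W₁) + Q₀ * W₂ = 0)
    (hτ : (τ * W₀).det ≠ 0) (h0 : (kkt K₀ (fromRows Q₀ τ)).det ≠ 0)
    (i1 : B₁ * W₀ = W₀ * C₁) (i2 : B₂ * W₀ + (2 : ℝ) • (B₁ * W₁) = (2 : ℝ) • (W₁ * C₁) + W₀ * C₂) (uC : secondVar (1 : Matrix ρ ρ ℝ) C₁ C₂ = 0)
    {K₁' K₂' : Matrix ν ν ℝ} {Q₁' Q₂' : Matrix μ ν ℝ}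
    (hK₁' : K₁' = A₁ᵀ * K₀ + K₁ + K₀ * A₁)
    (hK₂' : K₂' = A₂ᵀ * K₀ + (A₁ᵀ * K₁ + A₁ᵀ * K₀ * A₁) + ((A₁ᵀ * K₁ + A₁ᵀ * K₀ * A₁) + (K₂ + K₁ * A₁ + (K₁ * A₁ + K₀ * A₂))))
    (hQ₁' : Q₁' = Ā₁ * Q₀ + Q₁ + Q₀ * A₁)
    (hQ₂' : Q₂' = Ā₂ * Q₀ + (Ā₁ * Q₁ + Ā₁ * Q₀ * A₁) + ((Ā₁ * Q₁ + Ā₁ * Q₀ * A₁) + (Q₂ + Q₁ * A₁ + (Q₁ * A₁ + Q₀ * A₂)))) :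
    secondVar (kkt K₀ (fromRows Q₀ τ)) (kkt K₁' (fromRows Q₁' (0 : Matrix ρ ν ℝ))) (kkt K₂' (fromRows Q₂' (0 : Matrix ρ ν ℝ)))
      = secondVar (kkt K₀ (fromRows Q₀ τ)) (kkt K₁ (fromRows Q₁ (0 : Matrix ρ ν ℝ))) (kkt K₂ (fromRows Q₂ (0 : Matrix ρ ν ℝ))) := by
  subst hK₁' hK₂' hQ₁' hQ₂'
  have hI : (1 : Matrix ν ν ℝ).det ≠ 0 := by rw [Matrix.det_one]; exact one_ne_zero
  have hĪ : (1 : Matrix μ μ ℝ).det ≠ 0 := by rw [Matrix.det_one]; exact one_ne_zero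
  have hC : (1 : Matrix ρ ρ ℝ).det ≠ 0 := by rw [Matrix.det_one]; exact one_ne_zero
  have hτB : (τ * (1 : Matrix ν ν ℝ) * W₀).det ≠ 0 := by rw [Matrix.mul_one]; exact hτ
  have h0' : (kkt K₀ (fromRows Q₀ (τ * (1 : Matrix ν ν ℝ)))).det ≠ 0 := by rw [Matrix.mul_one]; exact h0
  have h := secondVar_kkt_conjTransport_static_of_intertwine (1 : Matrix ν ν ℝ) A₁ A₂ (1 : Matrix ν ν ℝ) B₁ B₂ K₀ K₁ K₂ (1 : Matrix μ μ ℝ) Ā₁ Ā₂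
    Q₀ Q₁ Q₂ τ W₀ W₁ W₂ (1 : Matrix ρ ρ ℝ) C₁ C₂ Y₀ Y₁ Y₂ Y'₀ Y'₁ Y'₂ hI hĪ (Matrix.mul_one _)
    (by rw [Matrix.mul_one, Matrix.one_mul]; exact b1) (by rw [Matrix.mul_one, Matrix.one_mul]; exact b2) uA uĀ
    a0 a1 a2 a0t a1t a2t c0 c1 c2 hτ hτB h0' hC (by rw [Matrix.one_mul, Matrix.mul_one])
    (by rw [Matrix.one_mul, Matrix.mul_one, i1, add_comm]) (by rw [Matrix.one_mul, Matrix.mul_one, i2]; abel) uC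
  simp only [Matrix.transpose_one, Matrix.one_mul, Matrix.mul_one] at h
  exact h

end Summit.QuantumFields.BalabanUV.Beta.FP.ExponentialTransportEnd

end
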